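import Summits.QuantumFields.BalabanUV.T4Continuum.Support.VariationalCovariantLipschitz

/-!
# T⁴ programme, spine node NE2 (U1a), lane P2 — THE TWO-RUNS FACE BY CONSTRAINT REPAIR («L-LIP′»): two backgrounds at the same
# level, NO rephasing — the constraint defect `Q_{T′} − Q_T` is repaired with leaf UB⁺ of the second datum, the form defect is the raw
# phase distance; additive defect `O(n·ρ + τ)` (road owner `b2b-balaban-t4-ne2-p2` gen 11; located remark N-ne2p2g11-3 and its resolution;
# `t4/skeletons/NE2-t4-ne2-p2.md` v0.12 §2.D-bis (iii), open item (O11))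

WHY.  Leaf L-LIP (`VariationalCovariantLipschitz.scalar_lipschitz_abs`, leaf-07 gen 2, p212809) transfers the constraint EXACTLY by the
re-phasing `u = conj T′·T` and pays the ALIGNED connection distance `ρ_al = ‖conj(u y)·R′·u(y+e) − R‖`.  For two runs whose transports are
NESTED composites (as COMP⁺ requires) `u` jumps across coarse sub-faces by the flux of `F − F̄` through lineage regions of PHYSICAL size, so
`ρ_al = Θ(ε)` there (N-ne2p2g11-3) and `√d·n·ρ_al` does not decay unless node NE3's rate beats `L⁻¹`.  The aligned distance is an artefact of
the method, not of the objects: `Δ′(μ) = min {Sc_R f : Q_T f = μ}` is Lipschitz in `(R, T)` for the RAW distances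

  `ρ := sup_bonds ‖R′ − R‖` (same gauge, no alignment),   `τ := sup_x ‖T′ x − T x‖`,

because the constraint can be REPAIRED instead of transferred: take the minimiser `f₀` of `(R, T)` at `μ`; its `T′`-average misses `μ` by
`r = Q_{T′} f₀ − μ` with `Σ|r|² ≤ τ²·qW f₀` (block Cauchy–Schwarz); subtract a leaf-UB⁺ competitor `g` of the datum `(R′, T′)` for `r`
(`Q_{T′} g = r`, `Sc′ g ≤ Λ′·Σ|r|²`); then `Q_{T′}(f₀ − g) = μ` and, by Minkowski for `√Sc′` and the raw form perturbation
`Sc′ f₀ ≤ (√Sc f₀ + √d·(nρ)·√qW f₀)²` (`Sc_perturb`, leaf-07, BY NAME),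

  `Δ′(R′,T′)(μ) ≤ Δ(R,T)(μ) + (2√Λ·D + D²)·nsq μ`,   `D = (√d·(n ρ) + √Λ′·τ)·√(C_P(Λ+1))`.

For Bałaban's two runs in a COMMON gauge `n·ρ ≍ ε_k` and `τ ≲ d·L/(L−1)·ε_k` (nested contours of length `≍ n` through bonds `ε_k/n` apart),
`ε_k` = node NE3's currency (`T4EtaRateMin.LocalRate`; leaf-09-g4's adapter `VariationalCovariantTwoRuns(NE3)`), so the two-runs face
closes at rate `max(L⁻¹, θ₃)` with NO restriction `θ₃ < L^{−1/2}` — resolving N-ne2p2g11-3.  (The READING is not asserted; NE3 OPEN.)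

HONEST FRAMING (T4-DAG p. 1).  Rung (B)+1 only — NOT infinite volume, NOT a mass gap, NOT Clay.  NE2 is NOT IN PRINT and NOT proved here.
MODEL LEVEL (U(1) phases and unit-modulus site transports = DATA; scalar sector); leaf UB⁺ for the primed datum, P⁺ and UB⁺ for the unprimed
datum are HYPOTHESES of exactly the shapes the road uses (`exists_ub_scalarPair(_rel_eff)`, `qW_le_coarse(_rel)`); [folklore]; nothing printed
is a hypothesis; no `def … : Prop`; no `sorry`; axioms standard.  HONEST DEPENDENCY (cell, verbatim): continuum YM on T⁴ ⇐ BetaPertH ∧ nine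
spine estimates (0/9 proved); BetaPertH ⇐ (D1) ∧ (D4) ∧ CAP+tail; G-an2-4 gates asym, D1 and NE2/3/4.
-/

noncomputable section

namespace Summit.QuantumFields.BalabanUV.T4Continuum.VariationalCovariantLipschitzRepair

open Finset
open scoped ComplexConjugate
open Literature.MathematicalPhysics.QuantumFieldTheory.Balaban1983to89
open Literature.MathematicalPhysics.QuantumFieldTheory.Balaban1983to89.B5Prop11Plancherel (Tor fine unitVec)
open Literature.MathematicalPhysics.QuantumFieldTheory.Balaban1983to89.B5Prop11Lower (nsq nsq_nonneg)
open Literature.MathematicalPhysics.QuantumFieldTheory.Balaban1983to89.B5Block118 (bpt)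
open Summit.QuantumFields.BalabanUV.T4Continuum.VariationalTransfer (blockSpin blockSpin_le blockSpin_eq_of_isMin)
open Summit.QuantumFields.BalabanUV.T4Continuum.VariationalCovariantFederbush (cD dirU Qc dirU_nonneg sum_sq_add_le)
open Summit.QuantumFields.BalabanUV.T4Continuum.VariationalCovariantAssembly (exists_isMinOn_fib defect_bound)
open Summit.QuantumFields.BalabanUV.T4Continuum.VariationalCovariantScalarPair (Sc qW Qk Sc_nonneg qW_nonneg norm_sq_le_qW continuous_Qc
  continuous_sum_dirU)
open Summit.QuantumFields.BalabanUV.T4Continuum.VariationalCovariantLipschitz (Sc_perturb)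

variable {d : ℕ}

/-! ## §1 The abstract repair lemma -/

section Abstract

variable {W Z : Type*} [NormedAddCommGroup W] [ProperSpace W] [AddCommGroup Z] [TopologicalSpace Z] [T1Space Z]

/-- **CONSTRAINT REPAIR**: two constrained minimisations `(Q, Sc)` and `(Q′, Sc′)` on the same carrier, `Q′` additive; leaf UB⁺ (`Λ`) and
leaf P⁺ (`C_P`) for the first, leaf UB⁺ (`Λ′`) for the second, the constraint defect `qZ (Q′ f − Q f) ≤ τ²·qW f`, the form perturbation
`Sc′ f ≤ (√Sc f + δ√qW f)²` and Minkowski for `√Sc′` ⟹ `T_{Q′}Sc′ (μ) ≤ T_Q Sc (μ) + (2√Λ·D + D²)·qZ μ`, `D = (δ + √Λ′·τ)·√(C_P(Λ+1))`.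
[folklore] -/
theorem repair_half
    {Q Q' : W → Z} {Sc Sc' : W → ℝ} {qW : W → ℝ} {qZ : Z → ℝ}
    (hQ : Continuous Q) (hSc : Continuous Sc)
    (hQ'sub : ∀ f g, Q' (f - g) = Q' f - Q' g)
    (hSc0 : ∀ f, 0 ≤ Sc f) (hSc'0 : ∀ f, 0 ≤ Sc' f) (hqZ0 : ∀ μ, 0 ≤ qZ μ)
    {κ Λ Λ' CP δ τ : ℝ} (hκ : 0 ≤ κ) (hΛ : 0 ≤ Λ) (hΛ' : 0 ≤ Λ') (hCP : 0 ≤ CP) (hδ : 0 ≤ δ) (hτ : 0 ≤ τ)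
    (hnormW : ∀ f, ‖f‖ ^ 2 ≤ κ * qW f)
    (hUB : ∀ μ, ∃ f, Q f = μ ∧ Sc f ≤ Λ * qZ μ)
    (hP : ∀ f, qW f ≤ CP * (Sc f + qZ (Q f)))
    (hUB' : ∀ r, ∃ g, Q' g = r ∧ Sc' g ≤ Λ' * qZ r)
    (hdef : ∀ f, qZ (Q' f - Q f) ≤ τ ^ 2 * qW f)
    (hpert : ∀ f, Sc' f ≤ (Real.sqrt (Sc f) + δ * Real.sqrt (qW f)) ^ 2)
    (hmink : ∀ f g, Sc' (f - g) ≤ (Real.sqrt (Sc' f) + Real.sqrt (Sc' g)) ^ 2)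
    (μ : Z) :
    blockSpin Q' Sc' μ ≤ blockSpin Q Sc μ
      + (2 * ((δ + Real.sqrt Λ' * τ) * Real.sqrt (CP * (Λ + 1))) * Real.sqrt Λ
          + ((δ + Real.sqrt Λ' * τ) * Real.sqrt (CP * (Λ + 1))) ^ 2) * qZ μ := by
  -- the minimiser of the first problem
  obtain ⟨fU, hfU, hfUb⟩ := hUB μ
  obtain ⟨f₀, hf₀, hmin⟩ := exists_isMinOn_fib (qZ := qZ) hQ hSc hκ hCP hnormW hP hfU
  have hz : 0 ≤ qZ μ := hqZ0 μ
  have hval : blockSpin Q Sc μ = Sc f₀ := blockSpin_eq_of_isMin hSc0 hf₀ hmin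
  have hSc_le : Sc f₀ ≤ Λ * qZ μ := (hmin fU hfU).trans hfUb
  have hqW_le : qW f₀ ≤ CP * (Λ + 1) * qZ μ := by
    calc qW f₀ ≤ CP * (Sc f₀ + qZ (Q f₀)) := hP f₀
      _ ≤ CP * (Λ * qZ μ + qZ μ) := by rw [hf₀]; gcongr
      _ = CP * (Λ + 1) * qZ μ := by ring
  -- the constraint defect and its repair
  set r : Z := Q' f₀ - μ with hr
  have hrq : qZ r ≤ τ ^ 2 * qW f₀ := by have := hdef f₀; rwa [hf₀] at this
  obtain ⟨g, hg, hgb⟩ := hUB' r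
  have hfeas : Q' (f₀ - g) = μ := by rw [hQ'sub, hg, hr]; abel
  -- the energy of the repaired competitor
  set A : ℝ := Real.sqrt (CP * (Λ + 1) * qZ μ) with hA
  have hA0 : 0 ≤ A := Real.sqrt_nonneg _
  have hsqW : Real.sqrt (qW f₀) ≤ A := Real.sqrt_le_sqrt hqW_le
  have hsqSc : Real.sqrt (Sc f₀) ≤ Real.sqrt (Λ * qZ μ) := Real.sqrt_le_sqrt hSc_le
  have hsqg : Real.sqrt (Sc' g) ≤ Real.sqrt Λ' * τ * A := by
    calc Real.sqrt (Sc' g) ≤ Real.sqrt (Λ' * (τ ^ 2 * qW f₀)) := Real.sqrt_le_sqrt (hgb.trans (by gcongr))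
      _ = Real.sqrt Λ' * τ * Real.sqrt (qW f₀) := by
          rw [Real.sqrt_mul hΛ', Real.sqrt_mul (sq_nonneg τ), Real.sqrt_sq hτ]; ring
      _ ≤ Real.sqrt Λ' * τ * A := by gcongr
  have hsqf₀ : Real.sqrt (Sc' f₀) ≤ Real.sqrt (Sc f₀) + δ * A := by
    have h := hpert f₀
    have h0 : 0 ≤ Real.sqrt (Sc f₀) + δ * Real.sqrt (qW f₀) := by positivity
    calc Real.sqrt (Sc' f₀) ≤ Real.sqrt ((Real.sqrt (Sc f₀) + δ * Real.sqrt (qW f₀)) ^ 2) := Real.sqrt_le_sqrt h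
      _ = Real.sqrt (Sc f₀) + δ * Real.sqrt (qW f₀) := Real.sqrt_sq h0
      _ ≤ Real.sqrt (Sc f₀) + δ * A := by gcongr
  have htot : Real.sqrt (Sc' (f₀ - g)) ≤ Real.sqrt (Sc f₀) + (δ + Real.sqrt Λ' * τ) * A := by
    have h := hmink f₀ g
    have h0 : 0 ≤ Real.sqrt (Sc' f₀) + Real.sqrt (Sc' g) := by positivity
    calc Real.sqrt (Sc' (f₀ - g)) ≤ Real.sqrt ((Real.sqrt (Sc' f₀) + Real.sqrt (Sc' g)) ^ 2) := Real.sqrt_le_sqrt h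
      _ = Real.sqrt (Sc' f₀) + Real.sqrt (Sc' g) := Real.sqrt_sq h0
      _ ≤ (Real.sqrt (Sc f₀) + δ * A) + Real.sqrt Λ' * τ * A := add_le_add hsqf₀ hsqg
      _ = Real.sqrt (Sc f₀) + (δ + Real.sqrt Λ' * τ) * A := by ring
  -- square and compare
  set D₀ : ℝ := δ + Real.sqrt Λ' * τ with hD₀
  have hD₀0 : 0 ≤ D₀ := by positivity
  have hrhs0 : 0 ≤ Real.sqrt (Sc f₀) + D₀ * A := by positivity
  have hsq : Sc' (f₀ - g) ≤ (Real.sqrt (Sc f₀) + D₀ * A) ^ 2 := by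
    have h1 : Real.sqrt (Sc' (f₀ - g)) ^ 2 ≤ (Real.sqrt (Sc f₀) + D₀ * A) ^ 2 := pow_le_pow_left₀ (Real.sqrt_nonneg _) htot 2
    rwa [Real.sq_sqrt (hSc'0 _)] at h1
  have hAsq : A ^ 2 = CP * (Λ + 1) * qZ μ := by rw [hA, Real.sq_sqrt (by positivity)]
  have hA' : A = Real.sqrt (CP * (Λ + 1)) * Real.sqrt (qZ μ) := by rw [hA, ← Real.sqrt_mul (by positivity)]
  have hcross : Real.sqrt (Sc f₀) * (D₀ * A) ≤ (D₀ * Real.sqrt (CP * (Λ + 1)) * Real.sqrt Λ) * qZ μ := by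
    calc Real.sqrt (Sc f₀) * (D₀ * A) ≤ Real.sqrt (Λ * qZ μ) * (D₀ * A) := by gcongr
      _ = (D₀ * Real.sqrt (CP * (Λ + 1)) * Real.sqrt Λ) * (Real.sqrt (qZ μ) * Real.sqrt (qZ μ)) := by
          rw [hA', Real.sqrt_mul hΛ]; ring
      _ = (D₀ * Real.sqrt (CP * (Λ + 1)) * Real.sqrt Λ) * qZ μ := by rw [Real.mul_self_sqrt hz]
  calc blockSpin Q' Sc' μ ≤ Sc' (f₀ - g) := blockSpin_le hSc'0 hfeas
    _ ≤ (Real.sqrt (Sc f₀) + D₀ * A) ^ 2 := hsq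
    _ = Sc f₀ + 2 * (Real.sqrt (Sc f₀) * (D₀ * A)) + D₀ ^ 2 * A ^ 2 := by
        rw [add_sq, Real.sq_sqrt (hSc0 _)]; ring
    _ ≤ Sc f₀ + 2 * ((D₀ * Real.sqrt (CP * (Λ + 1)) * Real.sqrt Λ) * qZ μ) + D₀ ^ 2 * (CP * (Λ + 1) * qZ μ) := by
        rw [hAsq]; linarith [hcross]
    _ = blockSpin Q Sc μ + (2 * (D₀ * Real.sqrt (CP * (Λ + 1))) * Real.sqrt Λ + (D₀ * Real.sqrt (CP * (Λ + 1))) ^ 2) * qZ μ := by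
        rw [hval, mul_pow, Real.sq_sqrt (by positivity : (0 : ℝ) ≤ CP * (Λ + 1))]; ring

end Abstract

/-! ## §2 The concrete pieces on the charged-scalar carriers -/

section Scalar

variable (n : ℕ) [NeZero n] (M : Fin d → ℕ) [hM : ∀ μ, NeZero (M μ)]

omit [NeZero n] hM in
/-- the transported average is additive in the field. [folklore] -/
theorem Qk_sub (T : Tor (fine n M) → ℂ) (f g : Tor (fine n M) → ℂ) : Qk n M T (f - g) = Qk n M T f - Qk n M T g := by
  funext z
  simp only [Qk, Qc, Pi.sub_apply, mul_sub, Finset.sum_sub_distrib]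

/-- **CONSTRAINT DEFECT from the raw transport distance**: `Σ_z |Q_{T′} f (z) − Q_T f (z)|² ≤ τ²·qW f` when `‖T′ x − T x‖ ≤ τ` (block
Cauchy–Schwarz). [folklore] -/
theorem nsq_Qk_sub_Qk_le {T T' : Tor (fine n M) → ℂ} {τ : ℝ} (hτ : ∀ x, ‖T' x - T x‖ ≤ τ) (f : Tor (fine n M) → ℂ) :
    nsq (Qk n M T' f - Qk n M T f) ≤ τ ^ 2 * qW n M f := by
  have hn0 : (0 : ℝ) < (n : ℝ) ^ d := by have := NeZero.ne n; positivity
  -- per block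
  have hz : ∀ z : Tor M, ‖(Qk n M T' f - Qk n M T f) z‖ ^ 2 ≤ τ ^ 2 * (((n : ℝ) ^ d)⁻¹ * ∑ j : Fin d → Fin n, ‖f (bpt n M z j)‖ ^ 2) := by
    intro z
    have hexpr : (Qk n M T' f - Qk n M T f) z = ((n : ℂ) ^ d)⁻¹ * ∑ j : Fin d → Fin n, (T' (bpt n M z j) - T (bpt n M z j)) * f (bpt n M z j) := by
      simp only [Pi.sub_apply, Qk, Qc, ← mul_sub, ← Finset.sum_sub_distrib, sub_mul]
    rw [hexpr, norm_mul, norm_inv, norm_pow, Complex.norm_natCast, mul_pow, inv_pow]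
    have hsum : ‖∑ j : Fin d → Fin n, (T' (bpt n M z j) - T (bpt n M z j)) * f (bpt n M z j)‖
        ≤ τ * ∑ j : Fin d → Fin n, ‖f (bpt n M z j)‖ := by
      rw [Finset.mul_sum]
      refine (norm_sum_le _ _).trans (Finset.sum_le_sum fun j _ => ?_)
      rw [norm_mul]
      exact mul_le_mul_of_nonneg_right (hτ _) (norm_nonneg _)
    have hcs : (∑ j : Fin d → Fin n, ‖f (bpt n M z j)‖) ^ 2 ≤ (n : ℝ) ^ d * ∑ j : Fin d → Fin n, ‖f (bpt n M z j)‖ ^ 2 := by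
      have h := sq_sum_le_card_mul_sum_sq (s := (Finset.univ : Finset (Fin d → Fin n))) (f := fun j => ‖f (bpt n M z j)‖)
      simpa [Finset.card_univ, Fintype.card_fun, Fintype.card_fin] using h
    have h1 : ‖∑ j : Fin d → Fin n, (T' (bpt n M z j) - T (bpt n M z j)) * f (bpt n M z j)‖ ^ 2
        ≤ τ ^ 2 * ((n : ℝ) ^ d * ∑ j : Fin d → Fin n, ‖f (bpt n M z j)‖ ^ 2) := by
      calc _ ≤ (τ * ∑ j : Fin d → Fin n, ‖f (bpt n M z j)‖) ^ 2 := pow_le_pow_left₀ (norm_nonneg _) hsum 2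
        _ = τ ^ 2 * (∑ j : Fin d → Fin n, ‖f (bpt n M z j)‖) ^ 2 := by ring
        _ ≤ τ ^ 2 * ((n : ℝ) ^ d * ∑ j : Fin d → Fin n, ‖f (bpt n M z j)‖ ^ 2) := mul_le_mul_of_nonneg_left hcs (sq_nonneg τ)
    calc (((n : ℝ) ^ d) ^ 2)⁻¹ * ‖∑ j : Fin d → Fin n, (T' (bpt n M z j) - T (bpt n M z j)) * f (bpt n M z j)‖ ^ 2
        ≤ (((n : ℝ) ^ d) ^ 2)⁻¹ * (τ ^ 2 * ((n : ℝ) ^ d * ∑ j : Fin d → Fin n, ‖f (bpt n M z j)‖ ^ 2)) :=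
          mul_le_mul_of_nonneg_left h1 (by positivity)
      _ = τ ^ 2 * (((n : ℝ) ^ d)⁻¹ * ∑ j : Fin d → Fin n, ‖f (bpt n M z j)‖ ^ 2) := by field_simp
  -- sum over blocks
  unfold nsq qW
  calc ∑ z, ‖(Qk n M T' f - Qk n M T f) z‖ ^ 2
      ≤ ∑ z, τ ^ 2 * (((n : ℝ) ^ d)⁻¹ * ∑ j : Fin d → Fin n, ‖f (bpt n M z j)‖ ^ 2) := Finset.sum_le_sum fun z _ => hz z
    _ = τ ^ 2 * (((n : ℝ) ^ d)⁻¹ * ∑ z, ∑ j : Fin d → Fin n, ‖f (bpt n M z j)‖ ^ 2) := by rw [← Finset.mul_sum, ← Finset.mul_sum]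
    _ = τ ^ 2 * (((n : ℝ) ^ d)⁻¹ * ∑ x, ‖f x‖ ^ 2) := by
        rw [B5AverageCurlStokes.sum_blocks_real n M (fun x => ‖f x‖ ^ 2)]

/-- **Minkowski for the covariant Dirichlet form**: `Sc (f − g) ≤ (√Sc f + √Sc g)²`. [folklore] -/
theorem Sc_sub_le (Rc : Tor (fine n M) → Fin d → ℂ) (f g : Tor (fine n M) → ℂ) :
    Sc n M Rc (f - g) ≤ (Real.sqrt (Sc n M Rc f) + Real.sqrt (Sc n M Rc g)) ^ 2 := by
  have hn0 : (0 : ℝ) ≤ (n : ℝ) ^ 2 / (n : ℝ) ^ d := by positivity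
  -- lattice Minkowski over the index pairs (μ, y)
  have hlat : ∑ μ, dirU (fine n M) Rc (f - g) μ
      ≤ (Real.sqrt (∑ μ, dirU (fine n M) Rc f μ) + Real.sqrt (∑ μ, dirU (fine n M) Rc g μ)) ^ 2 := by
    have hsplit : ∀ μ (y : Tor (fine n M)), ‖cD (fine n M) Rc (f - g) y μ‖ ≤ ‖cD (fine n M) Rc f y μ‖ + 1 * ‖cD (fine n M) Rc g y μ‖ := by
      intro μ y
      have e : cD (fine n M) Rc (f - g) y μ = cD (fine n M) Rc f y μ - cD (fine n M) Rc g y μ := by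
        simp only [cD, Pi.sub_apply]; ring
      rw [e, one_mul]; exact norm_sub_le _ _
    unfold dirU
    rw [← Finset.sum_product' (s := Finset.univ) (t := Finset.univ) (f := fun μ y => ‖cD (fine n M) Rc (f - g) y μ‖ ^ 2),
      ← Finset.sum_product' (s := Finset.univ) (t := Finset.univ) (f := fun μ y => ‖cD (fine n M) Rc f y μ‖ ^ 2),
      ← Finset.sum_product' (s := Finset.univ) (t := Finset.univ) (f := fun μ y => ‖cD (fine n M) Rc g y μ‖ ^ 2)]
    have h := sum_sq_add_le (Finset.univ ×ˢ Finset.univ) (fun p : Fin d × Tor (fine n M) => ‖cD (fine n M) Rc f p.2 p.1‖)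
      (fun p => ‖cD (fine n M) Rc g p.2 p.1‖) (m := 1) zero_le_one
    simp only [one_mul] at h
    refine le_trans (Finset.sum_le_sum fun p _ => ?_) h
    have := hsplit p.1 p.2
    rw [one_mul] at this
    exact pow_le_pow_left₀ (norm_nonneg _) this 2
  unfold Sc
  have e : ∀ X : ℝ, 0 ≤ X → Real.sqrt ((n : ℝ) ^ 2 / (n : ℝ) ^ d * X) = Real.sqrt ((n : ℝ) ^ 2 / (n : ℝ) ^ d) * Real.sqrt X := fun X _ =>
    Real.sqrt_mul hn0 X
  rw [e _ (Finset.sum_nonneg fun μ _ => dirU_nonneg _ _ _ _), e _ (Finset.sum_nonneg fun μ _ => dirU_nonneg _ _ _ _), ← mul_add,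
    mul_pow, Real.sq_sqrt hn0]
  exact mul_le_mul_of_nonneg_left hlat hn0

/-- **THE TWO-RUNS FACE BY CONSTRAINT REPAIR (one half)**: two backgrounds `(R, T)`, `(R′, T′)` at the same level with unit-modulus
transports, RAW distances `‖R′ − R‖ ≤ ρ` (bondwise, no alignment) and `‖T′ − T‖ ≤ τ` (sitewise), leaf UB⁺ (`Λ`) + P⁺ (`C_P`) for `(R, T)`,
leaf UB⁺ (`Λ′`) for `(R′, T′)` ⟹ `Δ′(R′,T′)(μ) ≤ Δ′(R,T)(μ) + (2√Λ·D + D²)·nsq μ`, `D = (√d·(nρ) + √Λ′·τ)·√(C_P(Λ+1))`. [folklore] -/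
theorem scalar_repair_half {R R' : Tor (fine n M) → Fin d → ℂ} {T T' : Tor (fine n M) → ℂ}
    {ρ τ : ℝ} (hρ0 : 0 ≤ ρ) (hρ : ∀ y μ, ‖R' y μ - R y μ‖ ≤ ρ) (hτ0 : 0 ≤ τ) (hτ : ∀ x, ‖T' x - T x‖ ≤ τ)
    {Λ Λ' CP : ℝ} (hΛ : 0 ≤ Λ) (hΛ' : 0 ≤ Λ') (hCP : 0 ≤ CP)
    (hUB : ∀ μ : Tor M → ℂ, ∃ f, Qk n M T f = μ ∧ Sc n M R f ≤ Λ * nsq μ)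
    (hP : ∀ f, qW n M f ≤ CP * (Sc n M R f + nsq (Qk n M T f)))
    (hUB' : ∀ r : Tor M → ℂ, ∃ g, Qk n M T' g = r ∧ Sc n M R' g ≤ Λ' * nsq r) (μ : Tor M → ℂ) :
    blockSpin (Qk n M T') (Sc n M R') μ ≤ blockSpin (Qk n M T) (Sc n M R) μ
      + (2 * ((Real.sqrt d * ((n : ℝ) * ρ) + Real.sqrt Λ' * τ) * Real.sqrt (CP * (Λ + 1))) * Real.sqrt Λ
          + ((Real.sqrt d * ((n : ℝ) * ρ) + Real.sqrt Λ' * τ) * Real.sqrt (CP * (Λ + 1))) ^ 2) * nsq μ := by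
  have hnd : (0 : ℝ) ≤ (n : ℝ) ^ d := by positivity
  refine repair_half (W := Tor (fine n M) → ℂ) (Z := Tor M → ℂ) (Q := Qk n M T) (Q' := Qk n M T') (Sc := Sc n M R) (Sc' := Sc n M R')
    (qW := qW n M) (qZ := nsq) (continuous_Qc T) (continuous_sum_dirU R _) (Qk_sub n M T') (Sc_nonneg n M R) (Sc_nonneg n M R')
    (fun μ => nsq_nonneg μ) hnd hΛ hΛ' hCP (by positivity) hτ0 (norm_sq_le_qW n M) hUB hP hUB' ?_ ?_
    (Sc_sub_le n M R') μ
  · intro f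
    exact nsq_Qk_sub_Qk_le n M hτ f
  · intro f
    exact Sc_perturb n M hρ0 hρ f

/-- **THE TWO-RUNS FACE BY CONSTRAINT REPAIR (symmetric)**: with UB⁺ + P⁺ for BOTH data, `|Δ′(R′,T′)(μ) − Δ′(R,T)(μ)| ≤ e_L·nsq μ`,
`e_L = 2√Λ·D + D²`, `D = (√d·(nρ) + √Λ·τ)·√(C_P(Λ+1))` (one common `Λ`). [folklore] -/
theorem scalar_repair_abs {R R' : Tor (fine n M) → Fin d → ℂ} {T T' : Tor (fine n M) → ℂ}
    {ρ τ : ℝ} (hρ0 : 0 ≤ ρ) (hρ : ∀ y μ, ‖R' y μ - R y μ‖ ≤ ρ) (hτ0 : 0 ≤ τ) (hτ : ∀ x, ‖T' x - T x‖ ≤ τ)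
    {Λ CP : ℝ} (hΛ : 0 ≤ Λ) (hCP : 0 ≤ CP)
    (hUB : ∀ μ : Tor M → ℂ, ∃ f, Qk n M T f = μ ∧ Sc n M R f ≤ Λ * nsq μ)
    (hP : ∀ f, qW n M f ≤ CP * (Sc n M R f + nsq (Qk n M T f)))
    (hUB' : ∀ μ : Tor M → ℂ, ∃ g, Qk n M T' g = μ ∧ Sc n M R' g ≤ Λ * nsq μ)
    (hP' : ∀ f, qW n M f ≤ CP * (Sc n M R' f + nsq (Qk n M T' f))) (μ : Tor M → ℂ) :
    |blockSpin (Qk n M T') (Sc n M R') μ - blockSpin (Qk n M T) (Sc n M R) μ|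
      ≤ (2 * ((Real.sqrt d * ((n : ℝ) * ρ) + Real.sqrt Λ * τ) * Real.sqrt (CP * (Λ + 1))) * Real.sqrt Λ
          + ((Real.sqrt d * ((n : ℝ) * ρ) + Real.sqrt Λ * τ) * Real.sqrt (CP * (Λ + 1))) ^ 2) * nsq μ := by
  have hρ' : ∀ y μ, ‖R y μ - R' y μ‖ ≤ ρ := fun y μ => by rw [norm_sub_rev]; exact hρ y μ
  have hτ' : ∀ x, ‖T x - T' x‖ ≤ τ := fun x => by rw [norm_sub_rev]; exact hτ x
  have h1 := scalar_repair_half n M hρ0 hρ hτ0 hτ hΛ hΛ hCP hUB hP hUB' μ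
  have h2 := scalar_repair_half n M hρ0 hρ' hτ0 hτ' hΛ hΛ hCP hUB' hP' hUB μ
  rw [abs_le]; constructor <;> linarith

end Scalar

end Summit.QuantumFields.BalabanUV.T4Continuum.VariationalCovariantLipschitzRepair

end
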